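import Summits.RiemannHypothesis.RiemannHypothesis.Theorems.PfPersistenceEdgeLawPohozaevInequality
import Summits.RiemannHypothesis.RiemannHypothesis.Theorems.PfPersistenceEdgeLaw
import HarnessLib

/-!
# The ONE-SIDED edge law from interior regularity (pub-rhpf theory-2, gen 4, Part F)

Mechanism/rigidity campaign; no RH claims. RH-free helper lemmas (item
stmt-RiemannHypothesis-19953, `--as helper`).

Theory-1's edge law in virial form (`PfPersistenceEdgeLaw`: `a·ε'(a) = −V` at every
differentiability window `a` of `ε = weilGroundEnergy`, i.e. almost every `a > 0`) combined with
theory-2's log-Pohozaev INEQUALITY from interior regularity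
(`PfPersistenceEdgeLawPohozaevInequality.virial_ge_of_interiorRegular`: `2c₀·a·I ≤ V` whenever the
interior dilation defect of the ground state is `o(η)`) gives the **one-sided edge law**
`ε'(a) ≤ −2c₀·I(u) = −I(u)` for every ground state `u` of a differentiability window with an edge
intensity and an `o(η)` interior defect — the quantitative half of "the window bottom decreases at
least at the rate of the edge intensity", with the log-Pohozaev IDENTITY (theory-1 R6, tree
hypothesis `WeilLogPohozaevAt`) replaced by the interior-regularity hypothesis (R3) alone; and the
a.e.-in-`a` packaging.

## References
* E. Bombieri, *Remarks on Weil's quadratic functional in the theory of prime numbers, I*,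
  Rend. Mat. Acc. Lincei (9) 11 (2000) 183–233, §4 Thm 3, §6, Thm 5.
-/

set_option linter.dupNamespace false

noncomputable section

open MeasureTheory Set Filter
open scoped Topology

namespace Summit.RiemannHypothesis.RiemannHypothesis.Theorems.PfPersistence

open Literature.NumberTheory.LFunctions
open Summit.RiemannHypothesis.RiemannHypothesis.Theorems.WeilWindowFlowGronwallLeakage
  (ae_differentiableAt_weilGroundEnergy)

variable {a : ℝ} {u : ℝ → ℂ}

/-- Interior regularity of the dilation defect of `u` at the window `a` (hypothesis (R3) of
`LayerRegularAt`, for ONE ground state): `D_a(t_η)/η → 0` as `η → 0⁺`. A DEFINITION used as a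
hypothesis (posited for the true ground state, HEURISTIC in the log-cusp model; not a fact).
[folklore] -/
def HasInteriorRegularDefect (a : ℝ) (u : ℝ → ℂ) : Prop :=
  Tendsto (fun η ↦ windowDefectForm a (weilInteriorDefect a u η) / η) (𝓝[>] 0) (𝓝 0)

/-- **One-sided edge law from interior regularity.** At a differentiability window `a` of
`ε = weilGroundEnergy`, every ground state `u` with a dilation virial, an edge intensity `I` and an
`o(η)` interior dilation defect satisfies `ε'(a) ≤ −2c₀·I` (`2c₀ = 1`).
[cite: Bombieri2000Weil, §4 Thm 3, §6] -/
theorem deriv_weilGroundEnergy_le_of_interiorRegular (hu : IsWeilGroundState a u)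
    (hd : DifferentiableAt ℝ weilGroundEnergy a) {V I : ℝ}
    (hV : HasDerivAt (weilDilationProfile a u) V 0) (hI : HasEdgeIntensity u a I)
    (htail : HasInteriorRegularDefect a u) :
    deriv weilGroundEnergy a ≤ -(2 * edgeLawKernelConstant * I) := by
  have ha : 0 < a := hu.pos
  have h1 := mul_deriv_weilGroundEnergy_eq_neg hu hd hV
  have h2 := virial_ge_of_interiorRegular hu hV hI htail
  rw [edgeLawKernelConstant] at h2 ⊢
  have h3 : a * (deriv weilGroundEnergy a + I) ≤ 0 := by nlinarith
  have h4 : deriv weilGroundEnergy a + I ≤ 0 := by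
    by_contra h
    exact absurd h3 (not_le.2 (mul_pos ha (not_le.1 h)))
  linarith

/-- Same, in `HasDerivAt` form: `ε` has derivative `ε'(a) ≤ −I` at `a`. [folklore] -/
theorem exists_hasDerivAt_weilGroundEnergy_le_of_interiorRegular (hu : IsWeilGroundState a u)
    (hd : DifferentiableAt ℝ weilGroundEnergy a) {V I : ℝ}
    (hV : HasDerivAt (weilDilationProfile a u) V 0) (hI : HasEdgeIntensity u a I)
    (htail : HasInteriorRegularDefect a u) :
    ∃ e' : ℝ, HasDerivAt weilGroundEnergy e' a ∧ e' ≤ -I := by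
  refine ⟨deriv weilGroundEnergy a, hd.hasDerivAt, ?_⟩
  have h := deriv_weilGroundEnergy_le_of_interiorRegular hu hd hV hI htail
  norm_num [edgeLawKernelConstant] at h
  linarith

/-- At a differentiability window, a ground state with an `o(η)` interior defect and a POSITIVE
edge intensity forces `ε'(a) < 0` (strict decrease of the window bottom at `a`). [folklore] -/
theorem deriv_weilGroundEnergy_neg_of_interiorRegular (hu : IsWeilGroundState a u)
    (hd : DifferentiableAt ℝ weilGroundEnergy a) {V I : ℝ}
    (hV : HasDerivAt (weilDilationProfile a u) V 0) (hI : HasEdgeIntensity u a I)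
    (htail : HasInteriorRegularDefect a u) (hI0 : 0 < I) : deriv weilGroundEnergy a < 0 := by
  have h := deriv_weilGroundEnergy_le_of_interiorRegular hu hd hV hI htail
  norm_num [edgeLawKernelConstant] at h
  linarith

/-- **The one-sided edge law holds at almost every window**: for a.e. `a > 0`, every ground state
`u` of the window `a` with a dilation virial, an edge intensity `I` and an `o(η)` interior dilation
defect has `ε'(a) ≤ −I`. (Bombieri Thm 5: `ε` is monotone, hence a.e. differentiable.)
[cite: Bombieri2000Weil, Thm 5] -/
theorem ae_deriv_weilGroundEnergy_le_of_interiorRegular :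
    ∀ᵐ a : ℝ, 0 < a → ∀ (u : ℝ → ℂ) (V I : ℝ), IsWeilGroundState a u →
      HasDerivAt (weilDilationProfile a u) V 0 → HasEdgeIntensity u a I →
      HasInteriorRegularDefect a u → deriv weilGroundEnergy a ≤ -I := by
  filter_upwards [ae_differentiableAt_weilGroundEnergy] with a ha hpos u V I hu hV hI htail
  have h := deriv_weilGroundEnergy_le_of_interiorRegular hu (ha hpos) hV hI htail
  norm_num [edgeLawKernelConstant] at h
  linarith

/-- Consistency with the reduction of R6: interior regularity for every ground state together with
(R2) is `LayerRegularAt a`, which gives the full identity `WeilLogPohozaevAt a`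
(`weilLogPohozaevAt_of_layerRegular`). [folklore] -/
theorem layerRegularAt_iff (a : ℝ) :
    LayerRegularAt a ↔ ∀ u : ℝ → ℂ, IsWeilGroundState a u →
      Tendsto (fun h ↦ edgeLayerLocalEnergy a u h / h) (𝓝[>] 0) (𝓝 0) ∧
        HasInteriorRegularDefect a u :=
  Iff.rfl

end Summit.RiemannHypothesis.RiemannHypothesis.Theorems.PfPersistence

end
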